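import Summits.BirchSwinnertonDyer.BirchSwinnertonDyer.Theses.SignedBaseChange
import Summits.BirchSwinnertonDyer.BirchSwinnertonDyer.Theorems.SignedBaseChangeAnticyclotomicEisensteinDivisibilityRatToInt
import Literature.NumberTheory.EllipticCurves.YanZhu2026.GreenbergDivisibilityProofs
import Literature.NumberTheory.EllipticCurves.BurungaleSkinnerTianWan2024.GreenbergBDPComparisonSupersingularPRE
import Literature.NumberTheory.EllipticCurves.BurungaleCastellaSkinner2025.GreenbergMuInvariantGoodReduction
import HarnessLib

/-!
# Crux idea `vertss` for stmt-BirchSwinnertonDyer-20727 `AnticyclotomicEisensteinDivisibility` — FIRST LEMMA (sketch)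

Seat bsd-idea-14 g3 (planner, lens = complete). BSD is NOT proved here; nothing below is a route item.

`TwoVarVerticalInclusionSS` (V) = the SINGLE-CURVE two-variable Greenberg inclusion
`(s) · ch(X_Gr₂(E/K̃_∞))^ur ⊆ (G)` UP TO a nonzero CYCLOTOMIC ("vertical") series `s ∈ 𝒪_{ℂ_p}⟦T₁⟧` — the
native output shape of every Eisenstein-congruence engine (Skinner–Urban GU(2,2) Thm 7.7 + Prop 13.6(1) read
"away from vertical primes", Yan–Zhu arXiv:2412.20078 Thm 1.6; the route's own K1″ has this shape for the twist
PRODUCT) — over EXACTLY the crux's binder telescope (minus its two by-name antecedents).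

`crux_of_vertical` (PROVED): V ⇒ the crux, by the tree's landed Weierstrass de-localisation
`Literature.NumberTheory.EllipticCurves.le_span_of_span_map_C_mul_le_of_hasUnitContent_minus` fed with
`μ(G⁻) = 0` from the crux's OWN antecedent (`…SignedBaseChangeAcDivRatToInt.hasUnitContent_minus_of_prop422`),
then `Ideal.map_mono` along `T₁ ↦ 0` (`UnrSeries₂.minus = PowerSeries.constantCoeff`). No control theorem, no
specialisation/Herbrand step, no statement on the anticyclotomic line is used.
-/

set_option autoImplicit false
set_option linter.dupNamespace false

namespace Summit.BirchSwinnertonDyer.BirchSwinnertonDyer.Cruxes.AnticyclotomicEisensteinDivisibility.Vertss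

open Summit.BirchSwinnertonDyer.BirchSwinnertonDyer.Theses.SignedBaseChange

/-- (V) single-curve two-variable Greenberg inclusion with vertical (cyclotomic) slack, over the crux binders. -/
def TwoVarVerticalInclusionSS : Prop :=
  ∀ (W : WeierstrassCurve ℚ) [W.IsElliptic] [W.IsGloballyMinimal] (p : ℕ) [Fact p.Prime], 5 ≤ p → W.HasGoodReductionAtPrime p → Literature.NumberTheory.EllipticCurves.Rank1Residual.Surj W p → ∀ (K : Type) [Field K] [NumberField K] (ι : PadicAlgCl p ≃+* ℂ) (v vbar : IsDedekindDomain.HeightOneSpectrum (NumberField.RingOfIntegers K)) (κ₁ κ₂ : Literature.NumberTheory.EllipticCurves.ZpExtension K p) (γ₁ γ₂ : Field.absoluteGaloisGroup K) [Fact (Literature.NumberTheory.EllipticCurves.ZpExtension.IsTopGeneratorPair κ₁ κ₂ γ₁ γ₂)] [NeZero (NumberField.discr K).natAbs] (N : ℕ) [NeZero N] (f : CuspForm (CongruenceSubgroup.Gamma0 N) 2), Literature.NumberTheory.EllipticCurves.ModularForms.IsNewformOf W f → (N : ℤ) = W.conductorNorm ℤ → Literature.NumberTheory.EllipticCurves.IsImaginaryQuadratic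 K → ((Ideal.span {(p : ℤ)}).primesOver (NumberField.RingOfIntegers K)).ncard = 2 → ((p : ℕ) : NumberField.RingOfIntegers K) ∈ v.asIdeal → ((p : ℕ) : NumberField.RingOfIntegers K) ∈ vbar.asIdeal → vbar ≠ v → (∀ (w : NumberField.InfinitePlace K) (k : NumberField.RingOfIntegers K), k ∈ v.asIdeal ↔ ‖ι.symm (w.embedding (k : K))‖ < 1) → IsCoprime (N : ℤ) (NumberField.discr K) → (∀ ℓ : ℕ, ℓ.Prime → ℓ ∣ N → ((Ideal.span {(ℓ : ℤ)}).primesOver (NumberField.RingOfIntegers K)).ncard = 2) → Odd (NumberField.discr K) → NumberField.discr K ≠ -3 → κ₁.IsCyclotomic → κ₂.IsAnticyclotomic → ∀ (Ω δ : ℂ) (Ωp : (Literature.NumberTheory.EllipticCurves.unrIntegers p)ˣ) (LK G : PowerSeries (PowerSeries (PadicComplexInt p))), Ω ≠ 0 → (δ ^ 2 = (NumberField.discr K : ℂ) ∨ δ ^ 2 = -(NumberField.discr K : ℂ)) → Literature.NumberTheory.EllipticCurves.IsKatzMeasure₂ ι v vbar ∅ κ₁ κ₂ γ₁⁻¹ γ₂⁻¹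 1 Ω δ ((Ωp : Literature.NumberTheory.EllipticCurves.unrIntegers p) : PadicComplex p) LK → Literature.NumberTheory.EllipticCurves.IsGreenbergLFunctionAnyRoot₂ ι v vbar κ₁ κ₂ γ₁⁻¹ γ₂⁻¹ f (NumberField.discr K).natAbs (NumberField.classNumber K) LK G → ∀ J : ℤ_[p] →+* PadicComplexInt p, (∀ x : ℤ_[p], ((J x : PadicComplexInt p) : PadicComplex p) = ((x : ℚ_[p]) : PadicComplex p)) → ∃ s : PowerSeries (PadicComplexInt p), s ≠ 0 ∧ Ideal.span {PowerSeries.map (PowerSeries.C (R := PadicComplexInt p)) s} * (WeierstrassCurve.XGr₂.charIdeal (W.baseChange K) p κ₁ κ₂ vbar γ₁ γ₂).map (Literature.NumberTheory.EllipticCurves.IwasawaAlgebra₂.toUnr₂ p J) ≤ Ideal.span {G}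

/-- The s-free single-curve inclusion, stated modulo the crux's antecedents (intermediate). -/
def TwoVarInclusionSS : Prop :=
  (Literature.NumberTheory.EllipticCurves.BurungaleCastellaSkinner2025.prop422_greenbergAnyRoot_hasUnitContent_minus ∧ Literature.NumberTheory.EllipticCurves.BurungaleSkinnerTianWan2024.props118_27_519_exists_signedTwoVariablePackage_supersingular_PRE) → Literature.NumberTheory.EllipticCurves.ModularForms.nonempty_modularParametrizationData → ∀ (W : WeierstrassCurve ℚ) [W.IsElliptic] [W.IsGloballyMinimal] (p : ℕ) [Fact p.Prime], 5 ≤ p → W.HasGoodReductionAtPrime p → Literature.NumberTheory.EllipticCurves.Rank1Residual.Surj W p → ∀ (K : Type) [Field K] [NumberField K] (ι : PadicAlgCl p ≃+* ℂ) (v vbar : IsDedekindDomain.HeightOneSpectrum (NumberField.RingOfIntegers K)) (κ₁ κ₂ : Literature.NumberTheory.EllipticCurves.ZpExtension K p) (γ₁ γ₂ : Field.absoluteGaloisGroup K) [Fact (Literature.NumberTheory.EllipticCurves.ZpExtension.IsTopGeneratorPair κ₁ κ₂ γ₁ γ₂)] [NeZero (NumberField.discr K).natAbs] (N : ℕ)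 [NeZero N] (f : CuspForm (CongruenceSubgroup.Gamma0 N) 2), Literature.NumberTheory.EllipticCurves.ModularForms.IsNewformOf W f → (N : ℤ) = W.conductorNorm ℤ → Literature.NumberTheory.EllipticCurves.IsImaginaryQuadratic K → ((Ideal.span {(p : ℤ)}).primesOver (NumberField.RingOfIntegers K)).ncard = 2 → ((p : ℕ) : NumberField.RingOfIntegers K) ∈ v.asIdeal → ((p : ℕ) : NumberField.RingOfIntegers K) ∈ vbar.asIdeal → vbar ≠ v → (∀ (w : NumberField.InfinitePlace K) (k : NumberField.RingOfIntegers K), k ∈ v.asIdeal ↔ ‖ι.symm (w.embedding (k : K))‖ < 1) → IsCoprime (N : ℤ) (NumberField.discr K) → (∀ ℓ : ℕ, ℓ.Prime → ℓ ∣ N → ((Ideal.span {(ℓ : ℤ)}).primesOver (NumberField.RingOfIntegers K)).ncard = 2) → Odd (NumberField.discr K) → NumberField.discr K ≠ -3 → κ₁.IsCyclotomic → κ₂.IsAnticyclotomic → ∀ (Ω δ : ℂ) (Ωp : (Literature.NumberTheory.EllipticCurves.unrIntegers p)ˣ) (LK G : PowerSeries (PowerSeries (PadicComplexInt p))), Ω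 ≠ 0 → (δ ^ 2 = (NumberField.discr K : ℂ) ∨ δ ^ 2 = -(NumberField.discr K : ℂ)) → Literature.NumberTheory.EllipticCurves.IsKatzMeasure₂ ι v vbar ∅ κ₁ κ₂ γ₁⁻¹ γ₂⁻¹ 1 Ω δ ((Ωp : Literature.NumberTheory.EllipticCurves.unrIntegers p) : PadicComplex p) LK → Literature.NumberTheory.EllipticCurves.IsGreenbergLFunctionAnyRoot₂ ι v vbar κ₁ κ₂ γ₁⁻¹ γ₂⁻¹ f (NumberField.discr K).natAbs (NumberField.classNumber K) LK G → ∀ J : ℤ_[p] →+* PadicComplexInt p, (∀ x : ℤ_[p], ((J x : PadicComplexInt p) : PadicComplex p) = ((x : ℚ_[p]) : PadicComplex p)) → (WeierstrassCurve.XGr₂.charIdeal (W.baseChange K) p κ₁ κ₂ vbar γ₁ γ₂).map (Literature.NumberTheory.EllipticCurves.IwasawaAlgebra₂.toUnr₂ p J) ≤ Ideal.span {G}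

/-- De-localisation: V ∧ (μ(G⁻) = 0 from the crux antecedent) ⇒ the s-free inclusion. -/
theorem sfree_of_vertical (hV : TwoVarVerticalInclusionSS) : TwoVarInclusionSS := by
  intro hIn hmod W _ _ p _ hp hgood hs K _ _ ι v vbar κ₁ κ₂ γ₁ γ₂ _ _ N _ f hf hN hK hsplit hv hvbar hvv hι hcop
    hHeeg hodd hne3 hκ₁ hκ₂ Ω δ Ωp LK G hΩ hδ hLK hG J hJ
  obtain ⟨s, hs0, hincl⟩ := hV W p hp hgood hs K ι v vbar κ₁ κ₂ γ₁ γ₂ N f hf hN hK hsplit hv hvbar hvv hι hcop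
    hHeeg hodd hne3 hκ₁ hκ₂ Ω δ Ωp LK G hΩ hδ hLK hG J hJ
  have hμ : Literature.NumberTheory.EllipticCurves.GreenbergVatsal2000.HasUnitContent
      (Literature.NumberTheory.EllipticCurves.UnrSeries₂.minus G) :=
    Summit.BirchSwinnertonDyer.BirchSwinnertonDyer.Theorems.SignedBaseChangeAcDivRatToInt.hasUnitContent_minus_of_prop422
      hIn.1 W hp hgood hs K ι v vbar κ₁ κ₂ γ₁ γ₂ hf hN hK hsplit hv hvbar hvv hι hcop hHeeg hodd hne3 hκ₁ hκ₂
      hΩ hδ hLK hG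
  exact Literature.NumberTheory.EllipticCurves.le_span_of_span_map_C_mul_le_of_hasUnitContent_minus hμ hs0 hincl

/-- Projection to the anticyclotomic line: the s-free inclusion ⇒ the crux (pure `Ideal.map_mono`). -/
theorem crux_of_sfree (h : TwoVarInclusionSS) : AnticyclotomicEisensteinDivisibility := by
  intro hIn hmod W _ _ p _ hp hgood hs K _ _ ι v vbar κ₁ κ₂ γ₁ γ₂ _ _ N _ f hf hN hK hsplit hv hvbar hvv hι hcop
    hHeeg hodd hne3 hκ₁ hκ₂ Ω δ Ωp LK G hΩ hδ hLK hG J hJ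
  have hle := h hIn hmod W p hp hgood hs K ι v vbar κ₁ κ₂ γ₁ γ₂ N f hf hN hK hsplit hv hvbar hvv hι hcop
    hHeeg hodd hne3 hκ₁ hκ₂ Ω δ Ωp LK G hΩ hδ hLK hG J hJ
  refine (Ideal.map_mono hle).trans ?_
  rw [Ideal.map_span, Set.image_singleton]
  rfl

/-- **First lemma of the card (PROVED): V ⇒ crux stmt-BirchSwinnertonDyer-20727, by name.** -/
theorem crux_of_vertical (hV : TwoVarVerticalInclusionSS) : AnticyclotomicEisensteinDivisibility :=
  crux_of_sfree (sfree_of_vertical hV)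


/-! ## Robustness to the staged 17-SS resplit: V also closes the FROZEN successor text C2 `AnticyclotomicEisensteinDivisibilityRatSS`
(children-ratSS.json sha16 6cd51ec97da8a782, item [0]; a_p = 0 inserted, Λ₂-torsion as hypothesis, conclusion rational up to `p^b`)
— with `b = 0`. The decl below is a LOCAL COPY of that frozen text (the successor item does not exist in the tree before the apply). -/

/-- LOCAL COPY (verbatim) of the frozen 17-SS successor statement C2 `AnticyclotomicEisensteinDivisibilityRatSS`. -/
def C2Frozen_AnticyclotomicEisensteinDivisibilityRatSS : Prop :=
  Literature.NumberTheory.EllipticCurves.BurungaleSkinnerTianWan2024.prop627_span_minus_eq_span_bdp_supersingular_PRE → Literature.NumberTheory.EllipticCurves.BurungaleCastellaSkinner2025.prop422_exists_isBDPLFunction_mu_eq_zero → (Literature.NumberTheory.EllipticCurves.BurungaleCastellaSkinner2025.prop422_greenbergAnyRoot_hasUnitContent_minus ∧ Literature.NumberTheory.EllipticCurves.BurungaleSkinnerTianWan2024.props118_27_519_exists_signedTwoVariablePackage_supersingular_PRE) → Literature.NumberTheory.EllipticCurves.ModularForms.nonempty_modularParametrizationData → ∀ (W : WeierstrassCurve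 ℚ) [W.IsElliptic] [W.IsGloballyMinimal] (p : ℕ) [Fact p.Prime], 5 ≤ p → W.HasGoodReductionAtPrime p → W.frobeniusTrace p = 0 → Literature.NumberTheory.EllipticCurves.Rank1Residual.Surj W p → ∀ (K : Type) [Field K] [NumberField K] (ι : PadicAlgCl p ≃+* ℂ) (v vbar : IsDedekindDomain.HeightOneSpectrum (NumberField.RingOfIntegers K)) (κ₁ κ₂ : Literature.NumberTheory.EllipticCurves.ZpExtension K p) (γ₁ γ₂ : Field.absoluteGaloisGroup K) [Fact (Literature.NumberTheory.EllipticCurves.ZpExtension.IsTopGeneratorPair κ₁ κ₂ γ₁ γ₂)] [NeZero (NumberField.discr K).natAbs] (N : ℕ) [NeZero N] (f : CuspForm (CongruenceSubgroup.Gamma0 N) 2), Literature.NumberTheory.EllipticCurves.ModularForms.IsNewformOf W f → (N : ℤ) = W.conductorNorm ℤ → Literature.NumberTheory.EllipticCurves.IsImaginaryQuadratic K → ((Ideal.span {(p : ℤ)}).primesOver (NumberField.RingOfIntegers K)).ncard = 2 → ((p : ℕ) : NumberField.RingOfIntegers K) ∈ v.asIdeal → ((p : ℕ) : NumberField.RingOfIntegers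 K) ∈ vbar.asIdeal → vbar ≠ v → (∀ (w : NumberField.InfinitePlace K) (k : NumberField.RingOfIntegers K), k ∈ v.asIdeal ↔ ‖ι.symm (w.embedding (k : K))‖ < 1) → IsCoprime (N : ℤ) (NumberField.discr K) → (∀ ℓ : ℕ, ℓ.Prime → ℓ ∣ N → ((Ideal.span {(ℓ : ℤ)}).primesOver (NumberField.RingOfIntegers K)).ncard = 2) → Odd (NumberField.discr K) → NumberField.discr K ≠ -3 → κ₁.IsCyclotomic → κ₂.IsAnticyclotomic → ∀ (Ω δ : ℂ) (Ωp : (Literature.NumberTheory.EllipticCurves.unrIntegers p)ˣ) (LK G : PowerSeries (PowerSeries (PadicComplexInt p))), Ω ≠ 0 → (δ ^ 2 = (NumberField.discr K : ℂ) ∨ δ ^ 2 = -(NumberField.discr K : ℂ)) → Literature.NumberTheory.EllipticCurves.IsKatzMeasure₂ ι v vbar ∅ κ₁ κ₂ γ₁⁻¹ γ₂⁻¹ 1 Ω δ ((Ωp : Literature.NumberTheory.EllipticCurves.unrIntegers p) : PadicComplex p) LK → Literature.NumberTheory.EllipticCurves.IsGreenbergLFunctionAnyRoot₂ ι v vbar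 κ₁ κ₂ γ₁⁻¹ γ₂⁻¹ f (NumberField.discr K).natAbs (NumberField.classNumber K) LK G → ∀ J : ℤ_[p] →+* PadicComplexInt p, (∀ x : ℤ_[p], ((J x : PadicComplexInt p) : PadicComplex p) = ((x : ℚ_[p]) : PadicComplex p)) → Module.IsTorsion (Literature.NumberTheory.EllipticCurves.IwasawaAlgebra₂ p) ((W.baseChange K).XGr₂ p κ₁ κ₂ vbar γ₁ γ₂) → ∃ b : ℕ, ∀ x ∈ ((WeierstrassCurve.XGr₂.charIdeal (W.baseChange K) p κ₁ κ₂ vbar γ₁ γ₂).map (Literature.NumberTheory.EllipticCurves.IwasawaAlgebra₂.toUnr₂ p J)).map (PowerSeries.constantCoeff (R := PowerSeries (PadicComplexInt p))), PowerSeries.C (((p : ℕ) : PadicComplexInt p) ^ b) * x ∈ Ideal.span {Literature.NumberTheory.EllipticCurves.UnrSeries₂.minus G}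

/-- V ⇒ the frozen successor C2 (with `b = 0`). -/
theorem c2Frozen_of_vertical (hV : TwoVarVerticalInclusionSS) : C2Frozen_AnticyclotomicEisensteinDivisibilityRatSS := by
  intro _h627 _h422bdp hIn hmod W _ _ p _ hp hgood _hap hs K _ _ ι v vbar κ₁ κ₂ γ₁ γ₂ _ _ N _ f hf hN hK hsplit hv hvbar hvv hι
    hcop hHeeg hodd hne3 hκ₁ hκ₂ Ω δ Ωp LK G hΩ hδ hLK hG J hJ _htors
  have hle := crux_of_vertical hV hIn hmod W p hp hgood hs K ι v vbar κ₁ κ₂ γ₁ γ₂ N f hf hN hK hsplit hv hvbar hvv hι hcop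
    hHeeg hodd hne3 hκ₁ hκ₂ Ω δ Ωp LK G hΩ hδ hLK hG J hJ
  exact ⟨0, fun x hx ↦ by simpa using hle hx⟩


/-! ## Scope note (v1.2): the cyclotomic CO-ANCHOR — abstract unit-lifting behind BSTW arXiv:2409.01350 Thm 2.8 («cf. [SU]»)

Bookkeeping for the route pen, NOT a line (it reduces the ES child to the slack-free single-curve parent shape + print).
Model: `R⟦T_ac⟧⟦T_cyc⟧ = PowerSeries (PowerSeries R)` (outer variable = cyclotomic, as in the crux: `UnrSeries₂.minus =
constantCoeff` kills `T_cyc` = anticyclotomic line); the CYCLOTOMIC line `T_ac ↦ 0` is `PowerSeries.map PowerSeries.constantCoeff`.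
If the two-variable Eisenstein inclusion holds SLACK-FREE in generator form `c = G * u` (`c` a generator of `ch(X_Gr₂)^ur`),
and on the cyclotomic line the Euler-system divisibility `c| ∣ G|` holds INTEGRALLY (in print at supersingular `p`, any `N`:
BSTW Cor. 1.23(a) under (ord),(coprime),(nv),(im) [held text p.73], modulo 2-var → cyc control) with `G| ≠ 0` ((nv), Rohrlich),
then `u` is a unit: `(c) = (G)`, i.e. BOTH children (ac-line Eisenstein AND two-variable ES, `a = 0`) follow.
With K1″'s VERTICAL slack `s(T_cyc)` the lift FAILS: `s = p`, `u = T_ac + p`, `c = (T_ac + p)·c′`, `G = p·c′` satisfy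
`s·c = G·u` and `c| ∣ G|` (both `= p·c′|`), yet `c ∤ p^a·G` for every `a` — the vertical slack is exactly what separates
the parent K1″ from the ES child. -/
section Coanchor

variable {R : Type*} [CommRing R]

/-- `constantCoeff ∘ constantCoeff` computes the double constant term through the cyclotomic-line restriction. -/
theorem constantCoeff_lineCyc (u : PowerSeries (PowerSeries R)) :
    PowerSeries.constantCoeff (PowerSeries.map (PowerSeries.constantCoeff (R := R)) u)
      = PowerSeries.constantCoeff (PowerSeries.constantCoeff u) := by
  rw [← PowerSeries.coeff_zero_eq_constantCoeff_apply, PowerSeries.coeff_map,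
    PowerSeries.coeff_zero_eq_constantCoeff_apply]

/-- A two-variable series is a unit as soon as its cyclotomic-line restriction is. -/
theorem isUnit_of_isUnit_lineCyc {u : PowerSeries (PowerSeries R)}
    (h : IsUnit (PowerSeries.map (PowerSeries.constantCoeff (R := R)) u)) : IsUnit u := by
  rw [PowerSeries.isUnit_iff_constantCoeff, constantCoeff_lineCyc] at h
  rw [PowerSeries.isUnit_iff_constantCoeff, PowerSeries.isUnit_iff_constantCoeff]
  exact h

variable [IsDomain R]

/-- **Co-anchor unit-lifting.** `c = G·u` (slack-free 2-var Eisenstein inclusion, generator form) + INTEGRAL cyclotomic-line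
ES divisibility `c| ∣ G|` + `G| ≠ 0` ⇒ `u` is a unit. -/
theorem isUnit_of_lineCyc_dvd {c G u : PowerSeries (PowerSeries R)} (h2 : c = G * u)
    (hES : PowerSeries.map (PowerSeries.constantCoeff (R := R)) c ∣ PowerSeries.map (PowerSeries.constantCoeff (R := R)) G)
    (hnv : PowerSeries.map (PowerSeries.constantCoeff (R := R)) G ≠ 0) : IsUnit u := by
  obtain ⟨w, hw⟩ := hES
  have h1 : PowerSeries.map (PowerSeries.constantCoeff (R := R)) c
      = PowerSeries.map (PowerSeries.constantCoeff (R := R)) G * PowerSeries.map (PowerSeries.constantCoeff (R := R)) u := by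
    rw [h2, map_mul]
  have h3 : PowerSeries.map (PowerSeries.constantCoeff (R := R)) G * 1
      = PowerSeries.map (PowerSeries.constantCoeff (R := R)) G * (PowerSeries.map (PowerSeries.constantCoeff (R := R)) u * w) := by
    rw [mul_one, ← mul_assoc, ← h1]; exact hw
  have h4 : PowerSeries.map (PowerSeries.constantCoeff (R := R)) u * w = 1 := (mul_left_cancel₀ hnv h3).symm
  exact isUnit_of_isUnit_lineCyc (IsUnit.of_mul_eq_one w h4)

/-- Hence the two-variable EQUALITY `(c) = (G)` … -/
theorem span_eq_of_lineCyc_dvd {c G u : PowerSeries (PowerSeries R)} (h2 : c = G * u)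
    (hES : PowerSeries.map (PowerSeries.constantCoeff (R := R)) c ∣ PowerSeries.map (PowerSeries.constantCoeff (R := R)) G)
    (hnv : PowerSeries.map (PowerSeries.constantCoeff (R := R)) G ≠ 0) : Ideal.span {c} = Ideal.span {G} := by
  have hu := isUnit_of_lineCyc_dvd h2 hES hnv
  rw [h2]
  exact Ideal.span_singleton_mul_right_unit hu G

/-- … and in particular the two-variable Euler-system direction `G ∈ (c)` (the ES child with `a = 0`). -/
theorem mem_span_of_lineCyc_dvd {c G u : PowerSeries (PowerSeries R)} (h2 : c = G * u)
    (hES : PowerSeries.map (PowerSeries.constantCoeff (R := R)) c ∣ PowerSeries.map (PowerSeries.constantCoeff (R := R)) G)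
    (hnv : PowerSeries.map (PowerSeries.constantCoeff (R := R)) G ≠ 0) : G ∈ Ideal.span {c} := by
  rw [span_eq_of_lineCyc_dvd h2 hES hnv]
  exact Ideal.mem_span_singleton_self G

end Coanchor

end Summit.BirchSwinnertonDyer.BirchSwinnertonDyer.Cruxes.AnticyclotomicEisensteinDivisibility.Vertss
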